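/-
Copyright: statement-level skeleton of a published paper (lit-balaban cell, Phase-2 proof seat p39 gen 7). No proof claims
beyond what the kernel checks below.
-/
import Literature.MathematicalPhysics.QuantumFieldTheory.Balaban1983to89.B3KernelConvolutionTorus

/-!
# B3 — T. Bałaban, *(Higgs)₂,₃ quantum fields in a finite volume. III. Renormalization*, CMP **88** (1983) 411–445
[Balaban1983Higgs3], p. 441 [PDF 31] with p. 437 [PDF 27]: a LATTICE CONVOLUTION ESTIMATE behind *"If at least one propagator
G_{j₀}(0) is replaced by G_{j₀}(0)(1 − m²_{j₀} − a_{j₀}P_{j₀})C^ξ, then we get a convergent expression"* (the vector self-energy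
functions Π_{μμ′}, Π_{μμ′ν} of (3.26)–(3.30)): on the `ξ`-lattice torus in `d = 3`, a `|y − z|^{−1}`-kernel (an undifferentiated
propagator) and a `|z − y′|^{−2}`-kernel (a differentiated one) convolve to at most `O(1)|y − y′|^{−1}e^{−γ|y−y′|}`, uniformly in
the spacing `0 < ξ ≤ 1` and in the volume (the true behaviour is logarithmic at short distances; the 1-profile majorant is what
the first differences `∂^ξM`, `M∂^{ξ*}` of `M = G(0)(1 − m² − aP)C^ξ` need)

statement-level skeleton of published theorems with citation tags; proofs where landed; nothing here is a claim about
the Yang–Mills mass gap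

PDF held: `paper:balaban1983-higgs-2-3-quantum-fields-finite-volume` (journal page = PDF page + 410); pp. 437, 441 read on the
×2 renders `run/shared/lean/pub/pub-balaban/b2b-balaban-ref1/pages/1983-cmp88-higgs23-III/1983-cmp88-higgs23-III-p027-x2.png`,
`…-p031-x2.png`.  Row **B3.Eq3.25-3.32** of `HOME/lit-balaban-r15/ROWS-B3.md` (fold owner r15): p. 441 [PDF 31] *"Next we replace the
propagator G_{j₀}(0) by C^ξ, ξ = L^{−j₀}, using the same equation as in (3.16). If at least one propagator G_{j₀}(0) is replaced by
G_{j₀}(0)(1 − m²_{j₀} − a_{j₀}P_{j₀})C^ξ, then we get a convergent expression."*; p. 437 [PDF 27]: *"Using the inequalities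
|C^ξ(y − y′)| ≦ O(1)e^{−½|y−y′|}/|y − y′|, |G^ξ_{j″}(0; y, y′)| ≦ O(1)e^{−δ₀|y−y′|}/|y − y′|, and the corresponding inequalities for
derivatives, we can estimate (3.16) by a constant."*  This seat's gen 7 proves the p. 441 sentence for the vector self-energy
functions Π_{μμ′}, Π_{μμ′ν} of (3.26)–(3.30) at the zero-field torus instance; the present file is part of its MODEL-FREE toolkit
(kernels on a torus level `Site P j`, volume element `ξ^d`, `d = 3`, "`p`-profiles" `(ξ·max(1,|y − z|_∞))^{−p}e^{−cξ|y−z|_∞}`,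
`|·|_∞` = `supDist` in lattice steps).
* **`conv12_le`**: `Σ_z ξ³|A(y,z)||B(z,y′)| ≤ ab·K₁₂·(ξ·max(1,|y−y′|))^{−1}e^{−γξ|y−y′|}` for a 1-profile `A` and a 2-profile `B`
  (all sites; `0 ≤ γ`, `2γ ≤ α, β`), `K₁₂ = 2(1 + R_{β/2}) + 8(1 + R_α) + 2(1 + R_β)`, `R_c = radialConst 3 c 1 0`.  Mechanism: where
  `|y − z| > 2|y − y′|` the 1-profile is `≤ (2ξ|y−y′|)^{−1}` and the 2-profile is summed; otherwise one factor carries half of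
  `|y − y′|` (`(ξ max(1,|y−z|))^{−1} ≤ 2ξ|y−y′|·(ξ max(1,|y−z|))^{−2}` on the ball) and a square profile is summed
  (`B3KernelConvolutionTorus.sum_profile_le`).
* **`conv21_le`**: the transposed form (2-profile then 1-profile).
File 3 of this seat's gen-7 toolkit (1: `B3TorusRadialTails`, 2: `B3KernelConvolutionTorusSharp`, 4: `B3KernelBlockSmearing`).
Mathlib + the cited tree files only; theorems only, no definitions, no named facts; standard axioms.  Unit `lit-balaban-p39-g7` (Phase-2 proof seat p39, gen 7),
HOME `run/shared/lean/pub/lit-balaban/`, 2026-08-21.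
-/

open scoped BigOperators

namespace Literature.MathematicalPhysics.QuantumFieldTheory.Balaban1983to89.B3KernelConvolutionTorusOneTwo

open LatticeFieldCalculus B3Sect3ScalarSelfEnergy B3TorusRadialSums B3Bound316 B3KernelConvolutionTorus

noncomputable section

variable {P : Params} {j : ℕ}

/-! ## A `|y − z|^{−1}`-kernel and a `|z − y′|^{−2}`-kernel -/

/-- **A 1-PROFILE AND A 2-PROFILE CONVOLVE TO AT MOST A 1-PROFILE** (`d = 3`, `0 < ξ ≤ 1`): if
`|A(y,z)| ≤ a(ξ·max(1,|y−z|))^{−1}e^{−αξ|y−z|}` and `|B(z,y′)| ≤ b(ξ·max(1,|z−y′|))^{−2}e^{−βξ|z−y′|}` at ALL sites, then for ALL `y, y′`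
and every `0 ≤ γ`, `2γ ≤ α`, `2γ ≤ β`:
`Σ_z ξ³|A(y,z)||B(z,y′)| ≤ ab(2(1 + R_{β/2}) + 8(1 + R_α) + 2(1 + R_β))·(ξ·max(1,|y−y′|))^{−1}e^{−γξ|y−y′|}`, `R_c = radialConst 3 c 1 0`
(the true behaviour is logarithmic at short distances; the 1-profile majorant is what the first differences `∂^ξM`, `M∂^{ξ*}` of
`M = G(0)(1 − m² − aP)C^ξ` need on p. 441). [cite: Balaban1983Higgs3, (3.16) p.437] -/
theorem conv12_le (hd : P.d = 3) {ξ : ℝ} (hξ : 0 < ξ) (hξ1 : ξ ≤ 1) {α β γ a b : ℝ} (hα : 0 < α) (hβ : 0 < β)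
    (hγ : 0 ≤ γ) (hγα : 2 * γ ≤ α) (hγβ : 2 * γ ≤ β) (ha : 0 ≤ a) (hb : 0 ≤ b) (A B : Kernel P j)
    (hA : ∀ y z : Site P j, |A y z| ≤
      a * ((ξ * max (1 : ℝ) (supDist y z : ℝ))⁻¹ * Real.exp (-(α * (ξ * (supDist y z : ℝ))))))
    (hB : ∀ z y' : Site P j, |B z y'| ≤
      b * (((ξ * max (1 : ℝ) (supDist z y' : ℝ)) ^ 2)⁻¹ * Real.exp (-(β * (ξ * (supDist z y' : ℝ))))))
    (y y' : Site P j) :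
    ∑ z : Site P j, ξ ^ P.d * (|A y z| * |B z y'|) ≤
      a * b * (2 * (1 + radialConst 3 (β / 2) 1 0) + 8 * (1 + radialConst 3 α 1 0) + 2 * (1 + radialConst 3 β 1 0)) *
        ((ξ * max (1 : ℝ) (supDist y y' : ℝ))⁻¹ * Real.exp (-(γ * (ξ * (supDist y y' : ℝ))))) := by
  classical
  have hξd : 0 ≤ ξ ^ P.d := by positivity
  have hexp1 : ∀ {c : ℝ} (_ : 0 ≤ c) (m : ℕ), Real.exp (-(c * (ξ * (m : ℝ)))) ≤ 1 := by
    intro c hc m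
    apply Real.exp_le_one_iff.mpr
    have : 0 ≤ c * (ξ * (m : ℝ)) := by positivity
    linarith
  -- the radial constants at ξ and at 1
  have hRm : ∀ {c : ℝ}, 0 < c → radialConst P.d c ξ 0 ≤ radialConst 3 c 1 0 := by
    intro c hc; rw [hd]; exact radialConst_mono 3 hc hξ1 0
  have hR₁ := radialConst_nonneg 3 (half_pos hβ) zero_le_one 0
  have hR₂ := radialConst_nonneg 3 hα zero_le_one 0
  have hR₃ := radialConst_nonneg 3 hβ zero_le_one 0
  obtain ⟨K, hK⟩ : ∃ K : ℝ, K = 2 * (1 + radialConst 3 (β / 2) 1 0) + 8 * (1 + radialConst 3 α 1 0) +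
      2 * (1 + radialConst 3 β 1 0) := ⟨_, rfl⟩
  rw [← hK]
  have hK0 : 0 ≤ K := by rw [hK]; positivity
  -- the three majorants (no indicators needed)
  obtain ⟨u₁, hu₁⟩ : ∃ u : Site P j → ℝ, u = fun z => ξ ^ P.d * (((ξ * max (1 : ℝ) (supDist y z : ℝ)) ^ 2)⁻¹ *
      Real.exp (-(β / 2 * (ξ * (supDist y z : ℝ))))) := ⟨_, rfl⟩
  obtain ⟨u₂, hu₂⟩ : ∃ u : Site P j → ℝ, u = fun z => ξ ^ P.d * (((ξ * max (1 : ℝ) (supDist y z : ℝ)) ^ 2)⁻¹ *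
      Real.exp (-(α * (ξ * (supDist y z : ℝ))))) := ⟨_, rfl⟩
  obtain ⟨u₃, hu₃⟩ : ∃ u : Site P j → ℝ, u = fun z => ξ ^ P.d * (((ξ * max (1 : ℝ) (supDist z y' : ℝ)) ^ 2)⁻¹ *
      Real.exp (-(β * (ξ * (supDist z y' : ℝ))))) := ⟨_, rfl⟩
  have hu₁0 : ∀ z, 0 ≤ u₁ z := fun z => by rw [hu₁]; positivity
  have hu₂0 : ∀ z, 0 ≤ u₂ z := fun z => by rw [hu₂]; positivity
  have hu₃0 : ∀ z, 0 ≤ u₃ z := fun z => by rw [hu₃]; positivity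
  have hs₁ : ∑ z, u₁ z ≤ 1 + radialConst 3 (β / 2) 1 0 := by
    rw [hu₁]; exact (sum_profile_le hd hξ hξ1 (half_pos hβ) y).trans (by have := hRm (half_pos hβ); linarith)
  have hs₂ : ∑ z, u₂ z ≤ 1 + radialConst 3 α 1 0 := by
    rw [hu₂]; exact (sum_profile_le hd hξ hξ1 hα y).trans (by have := hRm hα; linarith)
  have hs₃ : ∑ z, u₃ z ≤ 1 + radialConst 3 β 1 0 := by
    have h := sum_profile_le hd hξ hξ1 hβ y'
    simp only [supDist_comm y'] at h
    rw [hu₃]; exact h.trans (by have := hRm hβ; linarith)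
  by_cases hne : y' = y
  · -- the diagonal: `(ξ max(1,|y−z|))^{−1} ≤ ξ^{−1}`
    subst hne
    have hM1 : max (1 : ℝ) (supDist y' y' : ℝ) = 1 := max_one_supDist_self y'
    have hs0 : (supDist y' y' : ℝ) = 0 := by rw [(supDist_eq_zero_iff y' y').mpr rfl, Nat.cast_zero]
    rw [hM1, hs0]
    simp only [mul_zero, neg_zero, Real.exp_zero, mul_one]
    have hpt : ∀ z : Site P j, ξ ^ P.d * (|A y' z| * |B z y'|) ≤ a * b * ξ⁻¹ * u₂ z := by
      intro z
      have h1 := hA y' z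
      have h2 := hB z y'
      rw [supDist_comm z y'] at h2
      have hM1' : 1 ≤ max (1 : ℝ) (supDist y' z : ℝ) := le_max_left _ _
      have hinv : (ξ * max (1 : ℝ) (supDist y' z : ℝ))⁻¹ ≤ ξ⁻¹ := by
        apply inv_anti₀ hξ
        calc ξ = ξ * 1 := (mul_one ξ).symm
          _ ≤ ξ * max (1 : ℝ) (supDist y' z : ℝ) := mul_le_mul_of_nonneg_left hM1' hξ.le
      have hA'' : |A y' z| ≤ a * ξ⁻¹ * Real.exp (-(α * (ξ * (supDist y' z : ℝ)))) := h1.trans (by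
        rw [mul_assoc]
        exact mul_le_mul_of_nonneg_left (mul_le_mul_of_nonneg_right hinv (Real.exp_pos _).le) ha)
      have hB'' : |B z y'| ≤ b * ((ξ * max (1 : ℝ) (supDist y' z : ℝ)) ^ 2)⁻¹ := h2.trans (by
        refine mul_le_mul_of_nonneg_left ?_ hb
        calc ((ξ * max (1 : ℝ) (supDist y' z : ℝ)) ^ 2)⁻¹ * Real.exp (-(β * (ξ * (supDist y' z : ℝ))))
            ≤ ((ξ * max (1 : ℝ) (supDist y' z : ℝ)) ^ 2)⁻¹ * 1 :=
              mul_le_mul_of_nonneg_left (hexp1 hβ.le (supDist y' z)) (by positivity)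
          _ = _ := mul_one _)
      calc ξ ^ P.d * (|A y' z| * |B z y'|)
          ≤ ξ ^ P.d * ((a * ξ⁻¹ * Real.exp (-(α * (ξ * (supDist y' z : ℝ))))) *
              (b * ((ξ * max (1 : ℝ) (supDist y' z : ℝ)) ^ 2)⁻¹)) :=
            mul_le_mul_of_nonneg_left (mul_le_mul hA'' hB'' (abs_nonneg _) (by positivity)) hξd
        _ = a * b * ξ⁻¹ * u₂ z := by rw [hu₂]; ring
    calc ∑ z : Site P j, ξ ^ P.d * (|A y' z| * |B z y'|) ≤ ∑ z, a * b * ξ⁻¹ * u₂ z :=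
          Finset.sum_le_sum fun z _ => hpt z
      _ = a * b * ξ⁻¹ * ∑ z, u₂ z := by rw [Finset.mul_sum]
      _ ≤ a * b * ξ⁻¹ * (1 + radialConst 3 α 1 0) := mul_le_mul_of_nonneg_left hs₂ (by positivity)
      _ ≤ a * b * K * ξ⁻¹ := by
          have h0 : 0 ≤ a * b * ξ⁻¹ := by positivity
          have h1 : 1 + radialConst 3 α 1 0 ≤ K := by rw [hK]; linarith
          calc a * b * ξ⁻¹ * (1 + radialConst 3 α 1 0) ≤ a * b * ξ⁻¹ * K := mul_le_mul_of_nonneg_left h1 h0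
            _ = a * b * K * ξ⁻¹ := by ring
  · -- off the diagonal
    have hn1 : 1 ≤ supDist y y' := by
      by_contra h0
      exact hne (((supDist_eq_zero_iff y y').mp (by omega)).symm)
    have hn0 : (0 : ℝ) < (supDist y y' : ℝ) := by exact_mod_cast hn1
    have hnr1 : (1 : ℝ) ≤ (supDist y y' : ℝ) := by exact_mod_cast hn1
    rw [max_one_supDist_of_ne hne]
    obtain ⟨t, ht⟩ : ∃ t : ℝ, t = ξ * (supDist y y' : ℝ) := ⟨_, rfl⟩
    rw [← ht]
    have ht0 : 0 < t := by rw [ht]; exact mul_pos hξ hn0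
    obtain ⟨W, hW⟩ : ∃ W : ℝ, W = a * b * (t⁻¹ * Real.exp (-(γ * t))) := ⟨_, rfl⟩
    have hW0 : 0 ≤ W := by rw [hW]; positivity
    have four_inv : ∀ s : ℝ, 4 * (s ^ 2)⁻¹ = ((s / 2) ^ 2)⁻¹ := by
      intro s; rw [div_pow, inv_div, div_eq_mul_inv]; ring
    have hpt : ∀ z : Site P j, ξ ^ P.d * (|A y z| * |B z y'|) ≤ 2 * W * u₁ z + 8 * W * u₂ z + 2 * W * u₃ z := by
      intro z
      have htri1 : supDist y y' ≤ supDist y z + supDist z y' := supDist_triangle' y z y'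
      have htri2 : supDist y z ≤ supDist y y' + supDist z y' := by
        have := supDist_triangle' y y' z; rw [supDist_comm y' z] at this; exact this
      have hAz := hA y z
      have hBz := hB z y'
      have hp0 : (0 : ℝ) ≤ (supDist y z : ℝ) := by positivity
      have hq0 : (0 : ℝ) ≤ (supDist z y' : ℝ) := by positivity
      by_cases h1 : 2 * supDist y y' < supDist y z
      · -- `A ≤ a(2ξn)^{−1}e^{−γt}`, `B ≤ 4b(ξp)^{−2}e^{−(β/2)ξp}`: majorant `u₁`
        have hp3 : (1 : ℝ) ≤ (supDist y z : ℝ) := by exact_mod_cast (show 1 ≤ supDist y z by omega)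
        have hq1 : (1 : ℝ) ≤ (supDist z y' : ℝ) := by exact_mod_cast (show 1 ≤ supDist z y' by omega)
        have hpn : 2 * (supDist y y' : ℝ) ≤ (supDist y z : ℝ) := by
          exact_mod_cast (show 2 * supDist y y' ≤ supDist y z by omega)
        have hq2 : (supDist y z : ℝ) ≤ 2 * (supDist z y' : ℝ) := by
          exact_mod_cast (show supDist y z ≤ 2 * supDist z y' by omega)
        have hmp : max (1 : ℝ) (supDist y z : ℝ) = (supDist y z : ℝ) := max_eq_right hp3
        rw [hmp] at hAz
        rw [max_eq_right hq1] at hBz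
        have he1 : Real.exp (-(α * (ξ * (supDist y z : ℝ)))) ≤ Real.exp (-(γ * t)) := by
          apply Real.exp_le_exp.mpr
          have h3 : γ ≤ α := by linarith
          have h4 : γ * (ξ * (supDist y y' : ℝ)) ≤ α * (ξ * (supDist y z : ℝ)) :=
            calc γ * (ξ * (supDist y y' : ℝ)) ≤ α * (ξ * (supDist y y' : ℝ)) :=
                  mul_le_mul_of_nonneg_right h3 (by positivity)
              _ ≤ α * (ξ * (supDist y z : ℝ)) := by gcongr; linarith
          rw [ht]; linarith
        have hinv : (ξ * (supDist y z : ℝ))⁻¹ ≤ 2⁻¹ * t⁻¹ := by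
          rw [← mul_inv, ht]
          apply inv_anti₀ (by positivity)
          have := mul_le_mul_of_nonneg_left hpn hξ.le; linarith
        have he2 : Real.exp (-(β * (ξ * (supDist z y' : ℝ)))) ≤ Real.exp (-(β / 2 * (ξ * (supDist y z : ℝ)))) := by
          apply Real.exp_le_exp.mpr
          have h := mul_le_mul_of_nonneg_left hq2 (mul_nonneg hβ.le hξ.le)
          linarith
        have hpq : ((ξ * (supDist z y' : ℝ)) ^ 2)⁻¹ ≤ 4 * ((ξ * (supDist y z : ℝ)) ^ 2)⁻¹ := by
          rw [four_inv]
          apply inv_anti₀ (by positivity)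
          have : ξ * (supDist y z : ℝ) / 2 ≤ ξ * (supDist z y' : ℝ) := by
            have := mul_le_mul_of_nonneg_left hq2 hξ.le; linarith
          exact pow_le_pow_left₀ (by positivity) this 2
        have hA' : |A y z| ≤ a * (2⁻¹ * t⁻¹ * Real.exp (-(γ * t))) := by
          refine hAz.trans (mul_le_mul_of_nonneg_left ?_ ha)
          exact mul_le_mul hinv he1 (Real.exp_pos _).le (by positivity)
        have hB' : |B z y'| ≤ b * (4 * ((ξ * (supDist y z : ℝ)) ^ 2)⁻¹ *
            Real.exp (-(β / 2 * (ξ * (supDist y z : ℝ))))) := by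
          refine hBz.trans (mul_le_mul_of_nonneg_left ?_ hb)
          exact mul_le_mul hpq he2 (Real.exp_pos _).le (by positivity)
        have hu : u₁ z = ξ ^ P.d * (((ξ * (supDist y z : ℝ)) ^ 2)⁻¹ *
            Real.exp (-(β / 2 * (ξ * (supDist y z : ℝ))))) := by
          rw [hu₁]; dsimp only; rw [hmp]
        calc ξ ^ P.d * (|A y z| * |B z y'|)
            ≤ ξ ^ P.d * ((a * (2⁻¹ * t⁻¹ * Real.exp (-(γ * t)))) *
                (b * (4 * ((ξ * (supDist y z : ℝ)) ^ 2)⁻¹ * Real.exp (-(β / 2 * (ξ * (supDist y z : ℝ))))))) :=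
              mul_le_mul_of_nonneg_left (mul_le_mul hA' hB' (abs_nonneg _) (by positivity)) hξd
          _ = 2 * W * u₁ z := by rw [hu, hW]; ring
          _ ≤ 2 * W * u₁ z + 8 * W * u₂ z + 2 * W * u₃ z := by
              have := mul_nonneg hW0 (hu₂0 z); have := mul_nonneg hW0 (hu₃0 z); linarith
      · push Not at h1
        by_cases h2 : supDist y y' ≤ 2 * supDist z y'
        · -- `B ≤ 4b t^{−2}e^{−γt}`, `A ≤ 2ta·(ξ max(1,p))^{−2}e^{−αξp}`: majorant `u₂`
          have hq1 : (1 : ℝ) ≤ (supDist z y' : ℝ) := by exact_mod_cast (show 1 ≤ supDist z y' by omega)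
          rw [max_eq_right hq1] at hBz
          have hnq : (supDist y y' : ℝ) ≤ 2 * (supDist z y' : ℝ) := by exact_mod_cast h2
          have hp2 : (supDist y z : ℝ) ≤ 2 * (supDist y y' : ℝ) := by exact_mod_cast h1
          have hM0 : 0 < max (1 : ℝ) (supDist y z : ℝ) := lt_max_of_lt_left one_pos
          have hMle : max (1 : ℝ) (supDist y z : ℝ) ≤ 2 * (supDist y y' : ℝ) := max_le (by linarith) hp2
          have hqt : ((ξ * (supDist z y' : ℝ)) ^ 2)⁻¹ ≤ 4 * (t ^ 2)⁻¹ := by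
            rw [four_inv]
            apply inv_anti₀ (by positivity)
            have : t / 2 ≤ ξ * (supDist z y' : ℝ) := by
              rw [ht]; have := mul_le_mul_of_nonneg_left hnq hξ.le; linarith
            exact pow_le_pow_left₀ (by positivity) this 2
          have he2 : Real.exp (-(β * (ξ * (supDist z y' : ℝ)))) ≤ Real.exp (-(γ * t)) := by
            apply Real.exp_le_exp.mpr
            have h4 : γ * (ξ * (supDist y y' : ℝ)) ≤ β * (ξ * (supDist z y' : ℝ)) :=
              calc γ * (ξ * (supDist y y' : ℝ)) ≤ γ * (ξ * (2 * (supDist z y' : ℝ))) := by gcongr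
                _ = (2 * γ) * (ξ * (supDist z y' : ℝ)) := by ring
                _ ≤ β * (ξ * (supDist z y' : ℝ)) := mul_le_mul_of_nonneg_right hγβ (by positivity)
            rw [ht]; linarith
          -- `(ξM)^{−1} ≤ 2t·(ξM)^{−2}` since `ξM ≤ 2t`
          have hξM : 0 < ξ * max (1 : ℝ) (supDist y z : ℝ) := by positivity
          have hAM : (ξ * max (1 : ℝ) (supDist y z : ℝ))⁻¹ ≤ 2 * t * ((ξ * max (1 : ℝ) (supDist y z : ℝ)) ^ 2)⁻¹ := by
            have hle : ξ * max (1 : ℝ) (supDist y z : ℝ) ≤ 2 * t := by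
              rw [ht]; have := mul_le_mul_of_nonneg_left hMle hξ.le; linarith
            have key : 2 * t * ((ξ * max (1 : ℝ) (supDist y z : ℝ)) ^ 2)⁻¹ =
                (2 * t / (ξ * max (1 : ℝ) (supDist y z : ℝ))) * (ξ * max (1 : ℝ) (supDist y z : ℝ))⁻¹ := by
              rw [div_eq_mul_inv]; ring
            rw [key]
            calc (ξ * max (1 : ℝ) (supDist y z : ℝ))⁻¹ = 1 * (ξ * max (1 : ℝ) (supDist y z : ℝ))⁻¹ := (one_mul _).symm
              _ ≤ (2 * t / (ξ * max (1 : ℝ) (supDist y z : ℝ))) * (ξ * max (1 : ℝ) (supDist y z : ℝ))⁻¹ :=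
                  mul_le_mul_of_nonneg_right ((one_le_div hξM).mpr hle) (inv_nonneg.mpr hξM.le)
          have hA' : |A y z| ≤ a * (2 * t * (((ξ * max (1 : ℝ) (supDist y z : ℝ)) ^ 2)⁻¹ *
              Real.exp (-(α * (ξ * (supDist y z : ℝ)))))) := by
            refine hAz.trans (mul_le_mul_of_nonneg_left ?_ ha)
            calc (ξ * max (1 : ℝ) (supDist y z : ℝ))⁻¹ * Real.exp (-(α * (ξ * (supDist y z : ℝ))))
                ≤ (2 * t * ((ξ * max (1 : ℝ) (supDist y z : ℝ)) ^ 2)⁻¹) * Real.exp (-(α * (ξ * (supDist y z : ℝ)))) :=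
                  mul_le_mul_of_nonneg_right hAM (Real.exp_pos _).le
              _ = _ := by ring
          have hB' : |B z y'| ≤ b * (4 * (t ^ 2)⁻¹ * Real.exp (-(γ * t))) := by
            refine hBz.trans (mul_le_mul_of_nonneg_left ?_ hb)
            exact mul_le_mul hqt he2 (Real.exp_pos _).le (by positivity)
          have hu : u₂ z = ξ ^ P.d * (((ξ * max (1 : ℝ) (supDist y z : ℝ)) ^ 2)⁻¹ *
              Real.exp (-(α * (ξ * (supDist y z : ℝ))))) := by rw [hu₂]
          calc ξ ^ P.d * (|A y z| * |B z y'|)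
              ≤ ξ ^ P.d * ((a * (2 * t * (((ξ * max (1 : ℝ) (supDist y z : ℝ)) ^ 2)⁻¹ *
                  Real.exp (-(α * (ξ * (supDist y z : ℝ))))))) * (b * (4 * (t ^ 2)⁻¹ * Real.exp (-(γ * t))))) :=
                mul_le_mul_of_nonneg_left (mul_le_mul hA' hB' (abs_nonneg _) (by positivity)) hξd
            _ = 8 * W * u₂ z := by
                rw [hu, hW]
                field_simp
                ring
            _ ≤ 2 * W * u₁ z + 8 * W * u₂ z + 2 * W * u₃ z := by
                have := mul_nonneg hW0 (hu₁0 z); have := mul_nonneg hW0 (hu₃0 z); linarith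
        · -- `A ≤ 2a t^{−1}e^{−γt}`, `B` summed: majorant `u₃`
          push Not at h2
          have hp1 : (1 : ℝ) ≤ (supDist y z : ℝ) := by exact_mod_cast (show 1 ≤ supDist y z by omega)
          rw [max_eq_right hp1] at hAz
          have hnp : (supDist y y' : ℝ) ≤ 2 * (supDist y z : ℝ) := by
            exact_mod_cast (show supDist y y' ≤ 2 * supDist y z by omega)
          have hinv : (ξ * (supDist y z : ℝ))⁻¹ ≤ 2 * t⁻¹ := by
            rw [show (2 : ℝ) * t⁻¹ = (t / 2)⁻¹ by rw [inv_div, div_eq_mul_inv]]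
            apply inv_anti₀ (by positivity)
            rw [ht]; have := mul_le_mul_of_nonneg_left hnp hξ.le; linarith
          have he1 : Real.exp (-(α * (ξ * (supDist y z : ℝ)))) ≤ Real.exp (-(γ * t)) := by
            apply Real.exp_le_exp.mpr
            have h4 : γ * (ξ * (supDist y y' : ℝ)) ≤ α * (ξ * (supDist y z : ℝ)) :=
              calc γ * (ξ * (supDist y y' : ℝ)) ≤ γ * (ξ * (2 * (supDist y z : ℝ))) := by gcongr
                _ = (2 * γ) * (ξ * (supDist y z : ℝ)) := by ring
                _ ≤ α * (ξ * (supDist y z : ℝ)) := mul_le_mul_of_nonneg_right hγα (by positivity)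
            rw [ht]; linarith
          have hA' : |A y z| ≤ a * (2 * t⁻¹ * Real.exp (-(γ * t))) := by
            refine hAz.trans (mul_le_mul_of_nonneg_left ?_ ha)
            exact mul_le_mul hinv he1 (Real.exp_pos _).le (by positivity)
          have hu : u₃ z = ξ ^ P.d * (((ξ * max (1 : ℝ) (supDist z y' : ℝ)) ^ 2)⁻¹ *
              Real.exp (-(β * (ξ * (supDist z y' : ℝ))))) := by rw [hu₃]
          calc ξ ^ P.d * (|A y z| * |B z y'|)
              ≤ ξ ^ P.d * ((a * (2 * t⁻¹ * Real.exp (-(γ * t)))) *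
                  (b * (((ξ * max (1 : ℝ) (supDist z y' : ℝ)) ^ 2)⁻¹ * Real.exp (-(β * (ξ * (supDist z y' : ℝ))))))) :=
                mul_le_mul_of_nonneg_left (mul_le_mul hA' hBz (abs_nonneg _) (by positivity)) hξd
            _ = 2 * W * u₃ z := by rw [hu, hW]; ring
            _ ≤ 2 * W * u₁ z + 8 * W * u₂ z + 2 * W * u₃ z := by
                have := mul_nonneg hW0 (hu₁0 z); have := mul_nonneg hW0 (hu₂0 z); linarith
    calc ∑ z : Site P j, ξ ^ P.d * (|A y z| * |B z y'|)
        ≤ ∑ z, (2 * W * u₁ z + 8 * W * u₂ z + 2 * W * u₃ z) := Finset.sum_le_sum fun z _ => hpt z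
      _ = 2 * W * ∑ z, u₁ z + 8 * W * ∑ z, u₂ z + 2 * W * ∑ z, u₃ z := by
          rw [Finset.sum_add_distrib, Finset.sum_add_distrib, Finset.mul_sum, Finset.mul_sum, Finset.mul_sum]
      _ ≤ 2 * W * (1 + radialConst 3 (β / 2) 1 0) + 8 * W * (1 + radialConst 3 α 1 0) +
            2 * W * (1 + radialConst 3 β 1 0) := by gcongr
      _ = a * b * K * (t⁻¹ * Real.exp (-(γ * t))) := by rw [hW, hK]; ring

/-- The transposed form: a 2-profile followed by a 1-profile. [cite: Balaban1983Higgs3, (3.16) p.437] -/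
theorem conv21_le (hd : P.d = 3) {ξ : ℝ} (hξ : 0 < ξ) (hξ1 : ξ ≤ 1) {α β γ a b : ℝ} (hα : 0 < α) (hβ : 0 < β)
    (hγ : 0 ≤ γ) (hγα : 2 * γ ≤ α) (hγβ : 2 * γ ≤ β) (ha : 0 ≤ a) (hb : 0 ≤ b) (A B : Kernel P j)
    (hA : ∀ y z : Site P j, |A y z| ≤
      a * (((ξ * max (1 : ℝ) (supDist y z : ℝ)) ^ 2)⁻¹ * Real.exp (-(α * (ξ * (supDist y z : ℝ))))))
    (hB : ∀ z y' : Site P j, |B z y'| ≤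
      b * ((ξ * max (1 : ℝ) (supDist z y' : ℝ))⁻¹ * Real.exp (-(β * (ξ * (supDist z y' : ℝ))))))
    (y y' : Site P j) :
    ∑ z : Site P j, ξ ^ P.d * (|A y z| * |B z y'|) ≤
      b * a * (2 * (1 + radialConst 3 (α / 2) 1 0) + 8 * (1 + radialConst 3 β 1 0) + 2 * (1 + radialConst 3 α 1 0)) *
        ((ξ * max (1 : ℝ) (supDist y y' : ℝ))⁻¹ * Real.exp (-(γ * (ξ * (supDist y y' : ℝ))))) := by
  have hB' : ∀ w z : Site P j, |(fun w z : Site P j => B z w) w z| ≤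
      b * ((ξ * max (1 : ℝ) (supDist w z : ℝ))⁻¹ * Real.exp (-(β * (ξ * (supDist w z : ℝ))))) := by
    intro w z; have h := hB z w; simp only [supDist_comm z w] at h; exact h
  have hA' : ∀ z w : Site P j, |(fun z w : Site P j => A w z) z w| ≤
      a * (((ξ * max (1 : ℝ) (supDist z w : ℝ)) ^ 2)⁻¹ * Real.exp (-(α * (ξ * (supDist z w : ℝ))))) := by
    intro z w; have h := hA w z; simp only [supDist_comm w z] at h; exact h
  have h := conv12_le hd hξ hξ1 hβ hα hγ hγβ hγα hb ha (fun w z : Site P j => B z w) (fun z w : Site P j => A w z)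
    hB' hA' y' y
  simp only [supDist_comm y' y] at h
  refine le_trans (le_of_eq ?_) h
  exact Finset.sum_congr rfl fun z _ => by ring

end

end Literature.MathematicalPhysics.QuantumFieldTheory.Balaban1983to89.B3KernelConvolutionTorusOneTwo
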